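import Summits.MatrixMultiplication.OmegaCensus.SmallFormats.MatMul22nCensusCaps3n3
import HarnessLib

/-!
# ω-census family (a): the FUNNEL at `(9, 30)` over `𝔽₃` — either every rank-one plane carries `≤ 2` X-forms, or `σ ≥ 14` with a load-4 row AND a load-4 column

Cell `pub-omega` (unit `pub-omega-tensor`, gen 39), topic `Summits/MatrixMultiplication/OmegaCensus` (sub-folder
`SmallFormats`). Framing (verbatim): lottery ticket; floor = certified bounds/negative ranges. HONEST FRAMING: the first (pure `omega`)
split of the successor's cover certificate «(9,30): census clauses ⇒ the count vector is one of the 25 all-4 completions» (tensor g39 memo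
ALL4-SAT-g39 §6); kernel bookkeeping over the count vector; the first branch is already dead by `Enum723.no_cnt930_col2` (p718035). Nothing
here is a bound on any rank; nothing on `ω`.

* `Enum723.sum_inc_rows / sum_inc_cols` — table facts: a class lies in exactly one row plane and one column plane iff it is rank-one
  (classes `24–39`), in none otherwise.
* `Enum723.sum_load_rows_eq / sum_load_cols_eq` — `∑_{k∈[32,36)} load c k = ∑_{a∈[24,40)} c a = ∑_{k∈[36,40)} load c k` (=: `σ`, the
  number of rank-one X-forms).
* `Enum723.funnel_930` — for a `30`-term computation of `⟨2,2,9⟩` over `𝔽₃` with nowhere-zero X-marginal: EITHER all eight row/column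
  loads are `≤ 2`, OR `14 ≤ σ`, some row clause and some column clause have load exactly `4`, and every load is `≤ 4`.
* `Enum723.thirtyone_le_tensorRank_229_gf3_of_noLoadedPlane` — the rung CONDITIONAL on the second branch being empty: if no `30`-term
  computation has `σ ≥ 14` with a load-`4` row and a load-`4` column, then `31 ≤ R_𝔽₃(⟨2,2,9⟩)` (pipeline of p718035 with the funnel).
-/

namespace Summit.MatrixMultiplication.OmegaCensus.SmallFormats

open Finset Matrix
open Literature.Computability.AlgebraicComplexity
open Summit.MatrixMultiplication.OmegaCensus.RankOnePlaneCapGeneral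

namespace Enum723

/-- Table fact: the number of ROW planes (clauses `32–35`) containing class `a` is `1` for the rank-one classes `24–39`, `0` otherwise. -/
theorem sum_inc_rows : ∀ a, a < 40 → (∑ k ∈ Finset.Ico 32 36, inc a k) = if 24 ≤ a then 1 else 0 := by decide

/-- Table fact: the number of COLUMN planes (clauses `36–39`) containing class `a` is `1` for the rank-one classes `24–39`, `0` otherwise. -/
theorem sum_inc_cols : ∀ a, a < 40 → (∑ k ∈ Finset.Ico 36 40, inc a k) = if 24 ≤ a then 1 else 0 := by decide

/-- `∑_{k ∈ [32,36)} load c k = σ := ∑_{a ∈ [24,40)} c a`. -/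
theorem sum_load_rows_eq (c : ℕ → ℕ) : (∑ k ∈ Finset.Ico 32 36, load c k) = ∑ a ∈ Finset.Ico 24 40, c a := by
  simp only [load]
  rw [Finset.sum_comm]
  rw [show Finset.Ico 24 40 = (Finset.range 40).filter fun a => 24 ≤ a by ext a; simp [Finset.mem_Ico]; omega]
  rw [Finset.sum_filter]
  refine Finset.sum_congr rfl fun a ha => ?_
  rw [← Finset.mul_sum, sum_inc_rows a (Finset.mem_range.mp ha)]
  split_ifs <;> simp

/-- `∑_{k ∈ [36,40)} load c k = σ`. -/
theorem sum_load_cols_eq (c : ℕ → ℕ) : (∑ k ∈ Finset.Ico 36 40, load c k) = ∑ a ∈ Finset.Ico 24 40, c a := by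
  simp only [load]
  rw [Finset.sum_comm]
  rw [show Finset.Ico 24 40 = (Finset.range 40).filter fun a => 24 ≤ a by ext a; simp [Finset.mem_Ico]; omega]
  rw [Finset.sum_filter]
  refine Finset.sum_congr rfl fun a ha => ?_
  rw [← Finset.mul_sum, sum_inc_cols a (Finset.mem_range.mp ha)]
  split_ifs <;> simp

/-- **The funnel at `(9,30)`**: all eight rank-one-plane loads `≤ 2`, or (`σ ≥ 14`, a load-`4` row clause, a load-`4` column clause, all
loads `≤ 4`). -/
theorem funnel_930 (β : BilinComp (mulBilin (ZMod 3) 2 2 9) (Fin 30)) (hm : ∀ i, xMarginal β i ≠ 0) :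
    (∀ k, 32 ≤ k → k < 40 → load (cnt (xMarginal β)) k ≤ 2) ∨
    (14 ≤ ∑ a ∈ Finset.Ico 24 40, cnt (xMarginal β) a ∧ (∃ k, 32 ≤ k ∧ k < 36 ∧ load (cnt (xMarginal β)) k = 4) ∧
      (∃ k, 36 ≤ k ∧ k < 40 ∧ load (cnt (xMarginal β)) k = 4) ∧ ∀ k, 32 ≤ k → k < 40 → load (cnt (xMarginal β)) k ≤ 4) := by
  set c := cnt (xMarginal β) with hc
  have h4 : ∀ k, 32 ≤ k → k < 40 → load c k ≤ 4 := fun k hk1 hk2 =>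
    load_rowcol_le_four_3n3 (n := 9) (by norm_num) β hm k hk1 hk2
  have hP : ∀ k, 32 ≤ k → k < 40 → 3 ≤ load c k → 2 * 9 + load c k ≤ (∑ a ∈ Finset.Ico 24 40, c a) + 8 :=
    fun k hk1 hk2 h3 => loaded_plane_clause (n := 9) (by norm_num) β hm k hk1 hk2 h3
  have hrows := sum_load_rows_eq c
  have hcols := sum_load_cols_eq c
  rw [Finset.sum_Ico_succ_top (by norm_num), Finset.sum_Ico_succ_top (by norm_num), Finset.sum_Ico_succ_top (by norm_num),
    Finset.sum_Ico_succ_top (by norm_num), Finset.Ico_self, Finset.sum_empty] at hrows hcols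
  by_cases hall : ∀ k, 32 ≤ k → k < 40 → load c k ≤ 2
  · exact Or.inl hall
  right
  push Not at hall
  obtain ⟨k₀, hk1, hk2, hk3⟩ := hall
  have l32 := h4 32 (by norm_num) (by norm_num)
  have l33 := h4 33 (by norm_num) (by norm_num)
  have l34 := h4 34 (by norm_num) (by norm_num)
  have l35 := h4 35 (by norm_num) (by norm_num)
  have l36 := h4 36 (by norm_num) (by norm_num)
  have l37 := h4 37 (by norm_num) (by norm_num)
  have l38 := h4 38 (by norm_num) (by norm_num)
  have l39 := h4 39 (by norm_num) (by norm_num)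
  have p32 := hP 32 (by norm_num) (by norm_num)
  have p33 := hP 33 (by norm_num) (by norm_num)
  have p34 := hP 34 (by norm_num) (by norm_num)
  have p35 := hP 35 (by norm_num) (by norm_num)
  have p36 := hP 36 (by norm_num) (by norm_num)
  have p37 := hP 37 (by norm_num) (by norm_num)
  have p38 := hP 38 (by norm_num) (by norm_num)
  have p39 := hP 39 (by norm_num) (by norm_num)
  have pk := hP k₀ hk1 hk2 (by omega)
  have lk := h4 k₀ hk1 hk2
  -- σ ≥ 13 from the loaded plane k₀; then some row load is 4 (else Σ rows ≤ 12), hence σ ≥ 14; same for columns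
  have hσ : 13 ≤ ∑ a ∈ Finset.Ico 24 40, c a := by omega
  refine ⟨?_, ?_, ?_, h4⟩
  · by_contra hlt
    have : load c 32 ≤ 3 ∧ load c 33 ≤ 3 ∧ load c 34 ≤ 3 ∧ load c 35 ≤ 3 := by omega
    omega
  · by_contra hno
    push Not at hno
    have n32 : load c 32 ≠ 4 := fun h => hno 32 (by norm_num) (by norm_num) h
    have n33 : load c 33 ≠ 4 := fun h => hno 33 (by norm_num) (by norm_num) h
    have n34 : load c 34 ≠ 4 := fun h => hno 34 (by norm_num) (by norm_num) h
    have n35 : load c 35 ≠ 4 := fun h => hno 35 (by norm_num) (by norm_num) h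
    omega
  · by_contra hno
    push Not at hno
    have n36 : load c 36 ≠ 4 := fun h => hno 36 (by norm_num) (by norm_num) h
    have n37 : load c 37 ≠ 4 := fun h => hno 37 (by norm_num) (by norm_num) h
    have n38 : load c 38 ≠ 4 := fun h => hno 38 (by norm_num) (by norm_num) h
    have n39 : load c 39 ≠ 4 := fun h => hno 39 (by norm_num) (by norm_num) h
    omega

/-- **The `(9,30)` rung, conditional on the loaded branch being empty**: if no `30`-term `𝔽₃`-computation of `⟨2,2,9⟩` has `σ ≥ 14`
together with a load-`4` row clause and a load-`4` column clause, then `31 ≤ R_𝔽₃(⟨2,2,9⟩)`. -/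
theorem thirtyone_le_tensorRank_229_gf3_of_noLoadedPlane
    (H : ∀ β : BilinComp (mulBilin (ZMod 3) 2 2 9) (Fin 30),
      ¬ (14 ≤ ∑ a ∈ Finset.Ico 24 40, cnt (xMarginal β) a ∧ (∃ k, 32 ≤ k ∧ k < 36 ∧ load (cnt (xMarginal β)) k = 4) ∧
        (∃ k, 36 ≤ k ∧ k < 40 ∧ load (cnt (xMarginal β)) k = 4) ∧ ∀ k, 32 ≤ k → k < 40 → load (cnt (xMarginal β)) k ≤ 4)) :
    31 ≤ tensorRank (matMulTensor (ZMod 3) 2 2 9) := by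
  classical
  have hr : 30 ≤ tensorRank (matMulTensor (ZMod 3) 2 2 9) := by
    have h := (tensorRank_matMulTensor_22n_gf3_window 9 (by norm_num)).1
    have h' : max (3 * 9 + 2) ((36 * 9 + 10) / 11) = 30 := by norm_num
    omega
  refine succ_le_tensorRank_22n_of_orbit_census (k := ZMod 3) (n := 9) 30 ∅ (fun β => ?_) (by simp)
  exfalso
  have hm := xMarginal_ne_zero_of_le_tensorRank hr β
  rcases funnel_930 β hm with hall | hloaded
  · obtain ⟨hJ, -, -, -, ht⟩ := cnt_clauses (C := 10) (xMarginal β) hm (xCaps3_xMarginal β) fun X₀ hX₀ => by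
      have h := invLineCapHalfPlus_xMarginal (n := 9) (by norm_num) β X₀ hX₀; omega
    exact no_cnt930_col2 _ hJ (fun k hk1 hk2 => hall k (by omega) hk2) ht
  · exact H β hloaded

end Enum723

end Summit.MatrixMultiplication.OmegaCensus.SmallFormats
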